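import Literature.NumberTheory.EllipticCurves.PadicSeriesEvaluation
import Literature.NumberTheory.LocalFields.PadicAlgebraLogSeries
import Literature.NumberTheory.LocalFields.PadicExpLogHomomorphisms
import Mathlib.RingTheory.PowerSeries.WellKnown
import HarnessLib

/-!
# [telescope — width x2-p2 g24, 2026-08-30] THE INTEGRAL EXPONENTIAL SERIES `E_c = Σ (cⁿ/n!) Xⁿ ∈ ℤ_p⟦X⟧` (`p` odd, `‖c‖ ≤ p⁻¹`)
# and the Weierstrass remainder at a point of the open disc — the analytic half of the CRITICAL TWIST CHARACTER
# (transcription step (D8), flag `TG-twist`, of the assembled fact T-An-2ᵍ)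
# Crux 4 `BSDpOnCellC` (stmt-BirchSwinnertonDyer-19034), line «telescope» (`--supports`, helper; closes nothing)

WHY: T-An-2ᵍ (`Literature.NumberTheory.EllipticCurves.hida1986_castella2020_exists_galoisLattice_on_pNewBranchChart`) states the
member fibres of the branch lattice IN THE CRITICAL TWIST (`(D t).Δ.selfDualRep = Δ.ρ ⊗ ε^{1−k_t/2}`), whereas Hida 1986 Thm. 2.1 (2.2c)
gives them untwisted (`π mod P_f ≅ π(f)`). Step (D8) of the transcription bridges the two by the explicit character
`Θ(σ) = exp(c_σ X) = Σ (c_σⁿ/n!) Xⁿ ∈ ℤ_p⟦X⟧ˣ`, `c_σ = −(p^M/(2(p−1)))·log(ε(σ)^{p−1})`, whose value at the member point `x_t`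
(`p^M x_t = k_t − 2`, `2(p−1) ∣ k_t − 2`) is `ε(σ)^{1−k_t/2}` and at `X = 0` is `1`. THIS FILE supplies the series-level facts for ONE
parameter `c` (the character itself, `σ ↦ E_{c_σ}`, is assembled in the sequel `…TelescopeBranchTwistCharacter`): for `p ≠ 2` and
`‖c‖ ≤ p⁻¹`, an `E ∈ ℤ_p⟦X⟧` with coefficients `cⁿ/n!` EXISTS (`exists_expSeries`), any such `E` is `rescale c (exp ℚ_p)` after `ℤ_p → ℚ_p`
(`map_eq_rescale_exp`), hence MULTIPLICATIVE in `c` (`expSeries_mul`), `= 1` at `c = 0`, with constant coefficient `1`, and its VALUE at a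
point `x` of the open unit disc (the tree's `evalHom x`) is the `p`-adic exponential `exp(c·x)` (`coe_evalHom_expSeries`), so that
`evalHom x E = u^z` whenever `c·x = z·log u` (`coe_evalHom_expSeries_eq_zpow`, from the tree's `PadicAlgebra.exp_logSeries_eq_self`,
`exp_add_of_norm_le`); and, for ANY `F ∈ ℤ_p⟦X⟧` and `‖c‖ < 1`, the Weierstrass remainder `F = C(evalHom c F) + (X − C c)·U`
(`exists_eq_C_evalHom_add_X_sub_C_mul`) — the shape in which (G-fib_t) of `IsBranchGaloisLattice` reads fibres.

CONTENT (namespace `…Theorems.TelescopeBranchTwistExpSeries`; THEOREMS ONLY): §1 `evalHom_eq_tsum`, `exists_eq_C_evalHom_add_X_sub_C_mul`;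
§2 `norm_pow_div_factorial_le_one`, `exists_expSeries`, `map_eq_rescale_exp`, `expSeries_mul`, `expSeries_zero`, `constantCoeff_expSeries`,
`coe_evalHom_expSeries`; §3 `exp_intCast_mul_plog`, `coe_evalHom_expSeries_eq_zpow`.

HONEST FRAMING: `p`-adic analysis of one power series; no Galois representation, no character is constructed here; closes no registered
stub, no crux, no summit statement; BSD is proved for no curve by this file. No named fact, no definition, no instance, no `sorry`.
References (shape only): [cite: Howard2007BigHeegner, Def. 2.1.3 (the critical character `Θ`)] [cite: Robert2000PadicAnalysis, Ch. V §4.2 Prop. 3]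
-/

set_option autoImplicit false
set_option linter.dupNamespace false

noncomputable section

open scoped Classical
open Filter PowerSeries NormedSpace
open Literature.NumberTheory.EllipticCurves Literature.NumberTheory.LocalFields Literature.NumberTheory.Transcendental

namespace Summit.BirchSwinnertonDyer.BirchSwinnertonDyer.Theorems.TelescopeBranchTwistExpSeries

variable {p : ℕ} [hp : Fact p.Prime]

/-! ### §1. Evaluation as a sum, and the Weierstrass remainder at a point of the open unit disc -/

/-- `evalHom c F = Σ' aₙ cⁿ` in `ℤ_p` (`F = Σ aₙ Xⁿ`, `‖c‖ < 1`). [folklore] -/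
theorem evalHom_eq_tsum (F : ℤ_[p]⟦X⟧) {c : ℤ_[p]} (hc : ‖c‖ < 1) :
    evalHom c hc F = ∑' n : ℕ, coeff n F * c ^ n := by
  rw [evalHom_apply]
  have h := PowerSeries.hasSum_eval₂ (φ := RingHom.id ℤ_[p]) continuous_id (padicInt_hasEval hc) F
  simp only [RingHom.id_apply] at h
  exact h.tsum_eq.symm

/-- The shifted coefficient series `Σ_m a_{m+i} c^m` is summable in `ℤ_p` for `‖c‖ < 1`. [folklore] -/
theorem summable_coeff_add_mul_pow (F : ℤ_[p]⟦X⟧) {c : ℤ_[p]} (hc : ‖c‖ < 1) (i : ℕ) :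
    Summable fun m : ℕ => coeff (m + i) F * c ^ m := by
  refine Summable.of_norm_bounded (summable_geometric_of_lt_one (norm_nonneg c) hc) fun m => ?_
  rw [norm_mul, norm_pow]
  exact mul_le_of_le_one_left (pow_nonneg (norm_nonneg c) m) (PadicInt.norm_le_one _)

/-- **Weierstrass remainder at a point of the open unit disc.** For `F ∈ ℤ_p⟦X⟧` and `‖c‖ < 1` there is `U ∈ ℤ_p⟦X⟧` with
`F = C (F(c)) + (X − C c)·U`, `F(c) = evalHom c F` (explicitly `U = Σ_i (Σ_m a_{m+i+1} c^m) X^i`).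
[cite: Washington1997, §7.1 Prop. 7.2 (Weierstrass division by the distinguished polynomial `X − c`)] -/
theorem exists_eq_C_evalHom_add_X_sub_C_mul (F : ℤ_[p]⟦X⟧) {c : ℤ_[p]} (hc : ‖c‖ < 1) :
    ∃ U : ℤ_[p]⟦X⟧, F = C (evalHom c hc F) + (X - C c) * U := by
  let u : ℕ → ℤ_[p] := fun i => ∑' m : ℕ, coeff (m + (i + 1)) F * c ^ m
  have hu : ∀ i, u i = coeff (i + 1) F + c * u (i + 1) := by
    intro i
    change (∑' m : ℕ, coeff (m + (i + 1)) F * c ^ m) = coeff (i + 1) F + c * ∑' m : ℕ, coeff (m + (i + 1 + 1)) F * c ^ m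
    rw [(summable_coeff_add_mul_pow F hc (i + 1)).tsum_eq_zero_add, zero_add, pow_zero, mul_one,
      ← (summable_coeff_add_mul_pow F hc (i + 1 + 1)).tsum_mul_left]
    congr 1
    refine tsum_congr fun m => ?_
    rw [pow_succ, show m + 1 + (i + 1) = m + (i + 1 + 1) by ring]
    ring
  have h0 : evalHom c hc F = coeff 0 F + c * u 0 := by
    change evalHom c hc F = coeff 0 F + c * ∑' m : ℕ, coeff (m + (0 + 1)) F * c ^ m
    rw [evalHom_eq_tsum F hc, (summable_coeff_add_mul_pow F hc 0 |>.congr fun m => by rw [add_zero]).tsum_eq_zero_add,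
      pow_zero, mul_one, ← (summable_coeff_add_mul_pow F hc (0 + 1)).tsum_mul_left]
    congr 1
    refine tsum_congr fun m => ?_
    rw [pow_succ, show m + 1 = m + (0 + 1) by ring]
    ring
  refine ⟨PowerSeries.mk u, ?_⟩
  ext n
  rcases n with _ | i
  · rw [map_add, coeff_zero_C, sub_mul, map_sub, coeff_zero_X_mul, coeff_C_mul, coeff_mk, zero_sub, h0]
    ring
  · rw [map_add, coeff_C, if_neg (Nat.succ_ne_zero i), zero_add, sub_mul, map_sub, coeff_succ_X_mul, coeff_mk, coeff_C_mul,
      coeff_mk, hu i]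
    ring

/-! ### §2. The integral exponential series with parameter `c`, `‖c‖ ≤ p⁻¹`, `p ≠ 2` -/

/-- `‖cⁿ/n!‖ ≤ 1` for `‖c‖ ≤ p⁻¹`, `p ≠ 2` (indeed `≤ ‖c‖` for `n ≥ 1`, `≤ ‖c‖²` for `n ≥ 2`, `v_p(n!) ≤ n − 2`).
[cite: Robert2000PadicAnalysis, Ch. V §4.2 Prop. 1] -/
theorem norm_pow_div_factorial_le_one (hp2 : p ≠ 2) {c : ℚ_[p]} (hc : ‖c‖ ≤ (p : ℝ)⁻¹) (n : ℕ) :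
    ‖c ^ n / (n.factorial : ℚ_[p])‖ ≤ 1 := by
  have hp1 : (p : ℝ)⁻¹ ≤ 1 := inv_le_one_of_one_le₀ (by exact_mod_cast hp.out.one_lt.le)
  have hc1 : ‖c‖ ≤ 1 := hc.trans hp1
  rcases Nat.lt_or_ge n 2 with hn | hn
  · interval_cases n
    · simp
    · simp [hc1]
  · have h := PadicAlgebra.norm_exp_term_le (F := ℚ_[p]) hp2 hc hn
    rw [div_eq_inv_mul]
    exact h.trans (pow_le_one₀ (norm_nonneg c) hc1)

/-- **The integral exponential series exists**: for `p ≠ 2` and `‖c‖ ≤ p⁻¹` there is `E ∈ ℤ_p⟦X⟧` whose `n`-th coefficient is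
`cⁿ/n!` (unique, `ℤ_p → ℚ_p` being injective). [cite: Robert2000PadicAnalysis, Ch. V §4.1 Theorem] -/
theorem exists_expSeries (hp2 : p ≠ 2) {c : ℚ_[p]} (hc : ‖c‖ ≤ (p : ℝ)⁻¹) :
    ∃ E : ℤ_[p]⟦X⟧, ∀ n : ℕ, ((coeff n E : ℤ_[p]) : ℚ_[p]) = c ^ n / (n.factorial : ℚ_[p]) :=
  ⟨PowerSeries.mk fun n => ⟨c ^ n / (n.factorial : ℚ_[p]), norm_pow_div_factorial_le_one hp2 hc n⟩, fun n => by rw [coeff_mk]⟩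

/-- Such an `E` maps to `rescale c (exp ℚ_p) = Σ (cⁿ/n!) Xⁿ` in `ℚ_p⟦X⟧`. [cite: Robert2000PadicAnalysis, Ch. V §4.1 Theorem] -/
theorem map_eq_rescale_exp {c : ℚ_[p]} {E : ℤ_[p]⟦X⟧} (hE : ∀ n : ℕ, ((coeff n E : ℤ_[p]) : ℚ_[p]) = c ^ n / (n.factorial : ℚ_[p])) :
    E.map PadicInt.Coe.ringHom = rescale c (PowerSeries.exp ℚ_[p]) := by
  ext n
  rw [coeff_map, coeff_rescale, coeff_exp]
  change ((coeff n E : ℤ_[p]) : ℚ_[p]) = _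
  rw [hE n, div_eq_mul_inv, map_div₀, map_one, map_natCast, one_div]

/-- **Multiplicativity in the parameter**: `E_a · E_b = E_{a+b}` (the binomial theorem `exp(aX)exp(bX) = exp((a+b)X)`, Mathlib
`PowerSeries.exp_mul_exp_eq_exp_add`, read in `ℤ_p⟦X⟧`). [folklore] -/
theorem expSeries_mul {a b : ℚ_[p]} {Ea Eb Eab : ℤ_[p]⟦X⟧}
    (ha : ∀ n : ℕ, ((coeff n Ea : ℤ_[p]) : ℚ_[p]) = a ^ n / (n.factorial : ℚ_[p]))
    (hb : ∀ n : ℕ, ((coeff n Eb : ℤ_[p]) : ℚ_[p]) = b ^ n / (n.factorial : ℚ_[p]))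
    (hab : ∀ n : ℕ, ((coeff n Eab : ℤ_[p]) : ℚ_[p]) = (a + b) ^ n / (n.factorial : ℚ_[p])) : Ea * Eb = Eab := by
  -- compare images in `ℚ_p⟦X⟧` (the tree's `HondaFss.map_injective`, inlined to keep the import light)
  have h : (Ea * Eb).map (PadicInt.Coe.ringHom (p := p)) = Eab.map PadicInt.Coe.ringHom := by
    rw [map_mul, map_eq_rescale_exp ha, map_eq_rescale_exp hb, map_eq_rescale_exp hab, PowerSeries.exp_mul_exp_eq_exp_add]
  ext n
  have h1 := congrArg (coeff n) h
  rw [coeff_map, coeff_map] at h1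
  exact Subtype.ext h1

/-- At `c = 0` the series is `1`. [folklore] -/
theorem expSeries_zero {E : ℤ_[p]⟦X⟧} (hE : ∀ n : ℕ, ((coeff n E : ℤ_[p]) : ℚ_[p]) = (0 : ℚ_[p]) ^ n / (n.factorial : ℚ_[p])) : E = 1 := by
  have h : E.map (PadicInt.Coe.ringHom (p := p)) = (1 : ℤ_[p]⟦X⟧).map PadicInt.Coe.ringHom := by
    rw [map_eq_rescale_exp hE, map_one, rescale_zero, RingHom.comp_apply, constantCoeff_exp, map_one]
  ext n
  have h1 := congrArg (coeff n) h
  rw [coeff_map, coeff_map] at h1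
  exact Subtype.ext h1

/-- The constant coefficient is `1`. [folklore] -/
theorem constantCoeff_expSeries {c : ℚ_[p]} {E : ℤ_[p]⟦X⟧} (hE : ∀ n : ℕ, ((coeff n E : ℤ_[p]) : ℚ_[p]) = c ^ n / (n.factorial : ℚ_[p])) :
    constantCoeff E = 1 := by
  have h := hE 0
  rw [coeff_zero_eq_constantCoeff, pow_zero, Nat.factorial_zero, Nat.cast_one, div_one] at h
  exact Subtype.ext (h.trans PadicInt.coe_one.symm)

/-- **The value at a point of the open unit disc is the `p`-adic exponential**: `(evalHom x E : ℚ_p) = exp(c·x)` (`‖c‖ ≤ p⁻¹`, `p ≠ 2`,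
`‖x‖ < 1`; both sides are `Σ cⁿxⁿ/n!`). [cite: Robert2000PadicAnalysis, Ch. V §4.1 Theorem] -/
theorem coe_evalHom_expSeries (hp2 : p ≠ 2) {c : ℚ_[p]} (hc : ‖c‖ ≤ (p : ℝ)⁻¹) {E : ℤ_[p]⟦X⟧}
    (hE : ∀ n : ℕ, ((coeff n E : ℤ_[p]) : ℚ_[p]) = c ^ n / (n.factorial : ℚ_[p])) {x : ℤ_[p]} (hx : ‖x‖ < 1) :
    ((evalHom x hx E : ℤ_[p]) : ℚ_[p]) = exp (c * (x : ℚ_[p])) := by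
  have hcx : ‖c * (x : ℚ_[p])‖ ≤ (p : ℝ)⁻¹ := by
    rw [norm_mul]
    exact (mul_le_of_le_one_right (norm_nonneg c) (by simpa using PadicInt.norm_le_one x)).trans hc
  have h1 : HasSum (fun n : ℕ => ((coeff n E * x ^ n : ℤ_[p]) : ℚ_[p])) ((evalHom x hx E : ℤ_[p]) : ℚ_[p]) := by
    rw [evalHom_eq_tsum E hx]
    exact ((summable_coeff_add_mul_pow E hx 0 |>.congr fun m => by rw [add_zero]).hasSum).map
      (PadicInt.Coe.ringHom (p := p)).toAddMonoidHom continuous_subtype_val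
  have h2 := PadicAlgebra.hasSum_exp_of_norm_le (F := ℚ_[p]) hp2 hcx
  refine h1.unique (h2.congr_fun fun n => ?_)
  push_cast
  rw [hE n, mul_pow]
  ring

/-! ### §3. The value `u^z` when `c·x = z·log u` -/

/-- `exp (z · log u) = u ^ z` for a principal unit `‖u − 1‖ ≤ p⁻¹` of `ℚ_p`, `p ≠ 2`, `z ∈ ℤ` (`exp ∘ log = id` on `1 + pℤ_p`, the tree's
`PadicAlgebra.exp_logSeries_eq_self`, iterated with `exp_add`). [cite: Robert2000PadicAnalysis, Ch. V §4.2 Prop. 3] -/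
theorem exp_intCast_mul_plog (hp2 : p ≠ 2) {u : ℚ_[p]} (hu : ‖u - 1‖ ≤ (p : ℝ)⁻¹) (z : ℤ) :
    exp ((z : ℚ_[p]) * PadicExp.plog u) = u ^ z := by
  have hr := inv_lt_rpow_radius (p := p) hp2
  have hu' : ‖1 - u‖ ≤ (p : ℝ)⁻¹ := by rwa [norm_sub_rev]
  have hlog : ‖PadicExp.plog u‖ < (p : ℝ) ^ (-(1 : ℝ) / ((p : ℝ) - 1)) := by
    rw [norm_plog_of_norm_one_sub_lt_radius (p := p) (hu'.trans_lt hr)]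
    exact hu'.trans_lt hr
  have hexp : exp (PadicExp.plog u) = u := PadicAlgebra.exp_logSeries_eq_self (F := ℚ_[p]) hp2 hu
  obtain ⟨n, rfl | rfl⟩ := z.eq_nat_or_neg
  · rw [Int.cast_natCast, exp_natCast_mul_of_norm_lt_radius (p := p) hlog n, hexp, zpow_natCast]
  · rw [Int.cast_neg, Int.cast_natCast, neg_mul, exp_neg_of_norm_lt_radius (p := p), exp_natCast_mul_of_norm_lt_radius (p := p) hlog n,
      hexp, zpow_neg, zpow_natCast]
    rw [norm_mul]
    exact (mul_le_of_le_one_left (norm_nonneg _) (IwasawaLog.norm_natCast_le_one p (F := ℚ_[p]) n)).trans_lt hlog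

/-- **`evalHom x E_c = u ^ z` whenever `c·x = z·log u`** (`u` a principal unit `‖u − 1‖ ≤ p⁻¹`, `z ∈ ℤ`): the specialisation rule of the
critical twist character at a member point. [cite: Howard2007BigHeegner, Def. 2.1.3] -/
theorem coe_evalHom_expSeries_eq_zpow (hp2 : p ≠ 2) {c : ℚ_[p]} (hc : ‖c‖ ≤ (p : ℝ)⁻¹) {E : ℤ_[p]⟦X⟧}
    (hE : ∀ n : ℕ, ((coeff n E : ℤ_[p]) : ℚ_[p]) = c ^ n / (n.factorial : ℚ_[p])) {x : ℤ_[p]} (hx : ‖x‖ < 1)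
    {u : ℚ_[p]} (hu : ‖u - 1‖ ≤ (p : ℝ)⁻¹) {z : ℤ} (hz : c * (x : ℚ_[p]) = (z : ℚ_[p]) * PadicExp.plog u) :
    ((evalHom x hx E : ℤ_[p]) : ℚ_[p]) = u ^ z := by
  rw [coe_evalHom_expSeries hp2 hc hE hx, hz, exp_intCast_mul_plog hp2 hu z]

end Summit.BirchSwinnertonDyer.BirchSwinnertonDyer.Theorems.TelescopeBranchTwistExpSeries

end
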